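import Literature.AlgebraicGeometry.CossartPiltant2008to2019.DimensionFourChain
import Literature.AlgebraicGeometry.Resolution.RegularLocalRingsNormal
import Summits.ResolutionOfSingularities.ResolutionOfSingularities.Theorems.FrobeniusClosingSteerNormalStartDatum
import Summits.ResolutionOfSingularities.ResolutionOfSingularities.Theorems.FrobeniusClosingSteerWords03Phases
import Mathlib.FieldTheory.KummerPolynomial
import HarnessLib

/-!
# Crux `Steer` (stmt-ResolutionOfSingularities-16345), line `switching_dichotomy`: PLACEMENT of the torsor conclusion
# `Concl` / `TorsorLU p` below Cossart–Piltant's local theorem `LocalTheoremInDim d` (tree node, `3 ↦ d`)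

OURS (campaign `res-hironaka`, rung L ★L-G4, slot W4.1, chain W4.1; seat `res-L0-w41-strat-1` g6, crux strategist
alongside the holder res-L0-w41-lead-1; Theses-free, definition-light helper `--supports
stmt-ResolutionOfSingularities-16345`; replaces the role of no printed item; NOT a statement of the manuscript under
review [claim: Hironaka2017, status: under-review]; AI-produced, which is weaker than expert review). It is the proof
of the typed seam `(P)` of the strategist's census (STRATEGY-CENSUS-alpha-S3M.md rev 7 §A7.4,
Sketch-g6-Placement.lean): a kernel-checked LADDER CEILING / TRANSFER record for the four frontier stubs of the
skeleton of record (r37: `stub_eternalSteeredRunTwo`, `stub_compositeRankSS`, `stub_eternalCyclesSSM`,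
`stub_nonSwitchingCoreM` all conclude `Concl O A₀ t` under `CoreDatum p n …`).

* `concl_of_localTheoremInDim` (core): if the local theorem holds in ambient dimension `d` (`LocalTheoremInDim d`, the
  tree's `3 ↦ d` node of `DimensionFourChain` at universe `0`, asserted nowhere), then every torsor datum — `k ⊆
  A₀ ⊆ O ⊆ K`, `char k = p`, `A₀` a finitely generated `k`-subalgebra, `t ^ p ∈ A₀`, `Frac (A₀[t]) = K`, `A₀` regular
  at the centre of `O` with local ring `S = (A₀)_{𝔪_O ∩ A₀}` of Krull dimension `d` — satisfies `Concl O A₀ t` (a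
  finitely generated regular model `A ⊇ A₀[t]` of `K` dominated by `O`). Proof: `S` is an excellent (localization of a
  finite-type `k`-algebra) regular local domain with residue characteristic `p`; `F := Frac S ⊆ K`; either `t ∈ F`,
  and then `t ∈ S` because `S` is normal (`isIntegrallyClosed_of_isRegularLocalRing`) so `A := A₀[t]` itself works
  (same local ring at the centre), or `t ∉ F`, and then `h := X ^ p - t ^ p ∈ S[X]` is irreducible over `F`
  (`X_pow_sub_C_irreducible_of_prime` + injectivity of Frobenius), `K = F(t)`, case (i) of the local theorem applies
  to `(S, h, t, O)` and returns a finite `t' ⊆ O` with `S[t][t']` regular at the centre; `A := k[G₀, t, t']` (`G₀`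
  generators of `A₀`) has the same local ring at the centre [cite: NovacoskiSpivakovsky2014, Lemma 2.5].
* `concl_of_forall_localTheoremInDim`, `concl_of_localTheoremInDim_le` (with `ringKrullDim_locAtCentre_le`: `dim S ≤
  trdeg_k K`), `concl_of_cossartPiltant2019Local` (the case `dim S = 3` from the PRINTED theorem, via
  `localTheoremInDim_three_iff`), `concl_of_coreDatum_of_localTheoremInDim_le` (the skeleton's `CoreDatum p n` form:
  the local theorem in dimensions `≤ n` suffices), and the prime-by-prime torsor consequents
  `torsorLU_of_forall_localTheoremInDim : (∀ d, LocalTheoremInDim d) → TorsorLU p`,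
  `torsorLUZeroDim_of_forall_localTheoremInDim` (perfectness of `k` and the hypotheses on `O` are not used).

Reading (census, BC9-style): method family = Cossart–Piltant local uniformization of purely inseparable degree-`p`
torsors; every frontier stub of the line at level `n` is implied by `∀ d ≤ n, LocalTheoremInDim d`; the ceiling in
print is `d = 3` [cite: CossartPiltant2019, Thm. 1.5 (arXiv v1: Thm. 1.4), with 3 ↦ n]; no converse (stub ⇒ local
theorem) is claimed.
-/

-- `Summit.<S>.<S>.…` duplicates the summit name by design (single-problem summit).
set_option linter.dupNamespace false

open IsLocalRing Polynomial
open Literature.AlgebraicGeometry.Resolution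
open Literature.AlgebraicGeometry.CossartPiltant2008to2019
open Summit.ResolutionOfSingularities.ResolutionOfSingularities.Theorems.SteerRankThinness (Concl)
open Summit.ResolutionOfSingularities.ResolutionOfSingularities.Theorems.SwitchingDichotomy.Words
  (TorsorLU TorsorLUZeroDim CoreDatum)
open Summit.ResolutionOfSingularities.ResolutionOfSingularities.Theorems.SwitchingDichotomy.NormalStart
  (locAtCentre_eq_of_le_of_le isRegularLocalRing_centre_of_locAtCentre_eq)

namespace Summit.ResolutionOfSingularities.ResolutionOfSingularities.Theorems.SwitchingDichotomy.Placement

/- Everything is stated over `k K : Type` (universe `0`), as are the line's statements (`TorsorLU`, `CoreDatum`, …) and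
the landed `NormalStart` lemmas reused below; the tree node is instantiated as `LocalTheoremInDim.{0}`. -/

section Torsor

variable {k K : Type} [Field k] [Field K] [Algebra k K]

/-! ## Small glue (no new definitions) -/

/-- The subfield of `K` generated by a subring `S` is a fraction field of `S`. [folklore] -/
theorem isFractionRing_closure (S : Subring K) :
    letI := (S.subtype.codRestrict (Subfield.closure (S : Set K))
      (fun x => Subfield.subset_closure x.2)).toAlgebra
    IsFractionRing S (Subfield.closure (S : Set K)) := by
  letI := (S.subtype.codRestrict (Subfield.closure (S : Set K))
    (fun x => Subfield.subset_closure x.2)).toAlgebra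
  have hinj : Function.Injective (algebraMap S (Subfield.closure (S : Set K))) := by
    intro x y hxy
    have := congrArg Subtype.val hxy
    exact Subtype.ext this
  haveI : FaithfulSMul S (Subfield.closure (S : Set K)) :=
    (faithfulSMul_iff_algebraMap_injective _ _).mpr hinj
  apply IsFractionRing.of_field
  rintro ⟨z, hz⟩
  obtain ⟨x, hx, y, hy, hxy⟩ := (Subfield.mem_closure_iff).mp hz
  rw [Subring.closure_eq] at hx hy
  refine ⟨⟨x, hx⟩, ⟨y, hy⟩, Subtype.ext ?_⟩
  change z = x / y
  exact hxy.symm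

/-! ## The core: `Concl` from the local theorem in the dimension of the local ring at the centre -/

set_option maxHeartbeats 1600000 in
/-- **Core placement.** If Cossart–Piltant's local theorem holds in ambient dimension `d` (tree node
`LocalTheoremInDim d`), then every torsor datum `t ^ p ∈ A₀ ⊆ O` (`A₀` a finitely generated `k`-subalgebra of
`K` with `Frac (A₀[t]) = K`, regular at the centre of `O`, the local ring at the centre of dimension `d`, `char k = p`)
satisfies `Concl O A₀ t`. [cite: CossartPiltant2019, Thm. 1.5 (arXiv v1: Thm. 1.4), with 3 ↦ d] -/
theorem concl_of_localTheoremInDim (p d : ℕ) (hp : p.Prime) [CharP k p]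
    (hloc : LocalTheoremInDim.{0} d)
    (O : ValuationSubring K) (A₀ : Subalgebra k K) (h₀ : A₀.toSubring ≤ O.toSubring) (t : K)
    (hfg : A₀.FG) (htp : t ^ p ∈ A₀)
    (hfrac : IsFractionRing (Algebra.adjoin k (insert t (A₀ : Set K))) K)
    (hreg : IsRegularLocalRing (Localization.AtPrime
      (Ideal.comap (Subring.inclusion h₀) (IsLocalRing.maximalIdeal O))))
    (hdim : ringKrullDim (locAtCentre A₀.toSubring O) = d) :
    Concl O A₀ t := by
  classical
  haveI hpfact : Fact p.Prime := ⟨hp⟩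
  -- the local ring at the centre, inside `K`
  set S : Subring K := locAtCentre A₀.toSubring O with hSdef
  have hSO : S ≤ O.toSubring := locAtCentre_le h₀
  have hA₀S : A₀.toSubring ≤ S := le_locAtCentre _ O
  haveI hSloc : IsLocalRing S := isLocalRing_locAtCentre h₀
  haveI hSreg : IsRegularLocalRing S := (isRegularLocalRing_locAtCentre_iff h₀).mpr hreg
  -- excellence
  have hexc : IsExcellentRing S := by
    haveI : Algebra.FiniteType k A₀ := A₀.fg_iff_finiteType.mp hfg
    have hA : IsExcellentRing A₀ := isExcellentRing_of_finiteType_field k A₀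
    have hA' : IsExcellentRing A₀.toSubring := hA
    haveI := isLocalization_locAtCentre (B := A₀.toSubring) (O := O) h₀
    exact hA'.of_isLocalization (subringCentre A₀.toSubring O h₀).primeCompl
  -- residue characteristic
  have hchar : CharP (ResidueField S) p := by
    let ι : k →+* S :=
      { toFun := fun c => ⟨algebraMap k K c, hA₀S (A₀.algebraMap_mem c)⟩
        map_one' := Subtype.ext (by simp)
        map_mul' := fun a b => Subtype.ext (by simp)
        map_zero' := Subtype.ext (by simp)
        map_add' := fun a b => Subtype.ext (by simp) }
    exact charP_of_injective_ringHom ((IsLocalRing.residue S).comp ι).injective p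
  -- the field of fractions of `S` inside `K`
  set F : Subfield K := Subfield.closure (S : Set K) with hFdef
  have hSF : ∀ x ∈ S, x ∈ F := fun _ hx => Subfield.subset_closure hx
  letI algSF : Algebra S F := (S.subtype.codRestrict F (fun x => hSF x x.2)).toAlgebra
  haveI : IsScalarTower S F K := IsScalarTower.of_algebraMap_eq (fun _ => rfl)
  haveI : IsFractionRing S F := isFractionRing_closure S
  haveI : CharP K p := charP_of_injective_algebraMap (algebraMap k K).injective p
  haveI : CharP F p := (Subfield.subtype F).charP Subtype.val_injective p
  -- the polynomial `X ^ p - t ^ p`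
  set f₀ : S := ⟨t ^ p, hA₀S htp⟩ with hf₀
  set h : S[X] := X ^ p - C f₀ with hhdef
  have hmonic : h.Monic := monic_X_pow_sub_C f₀ hp.ne_zero
  have hdeg : h.natDegree = p := natDegree_X_pow_sub_C
  have hcoeff : ∀ i, 0 < i → i < p → h.coeff i = 0 := by
    intro i hi hip
    simp [hhdef, coeff_X_pow, coeff_C, hip.ne, hi.ne']
  have hf₀K : algebraMap S K f₀ = t ^ p := rfl
  have hf₀F : ((algebraMap S F f₀ : F) : K) = t ^ p := rfl
  have haeval : aeval t h = 0 := by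
    simp [hhdef, hf₀K]
  -- generators of `A₀`
  obtain ⟨G₀, hG₀⟩ := hfg
  by_cases htF : t ∈ F
  · -- degenerate torsor: `t ∈ Frac A₀`, hence `t ∈ S` by normality of the regular local ring `S`
    have htS : t ∈ S := by
      haveI := isIntegrallyClosed_of_isRegularLocalRing S
      have hint : IsIntegral S ((⟨t, htF⟩ : F) ^ p) := by
        have : (⟨t, htF⟩ : F) ^ p = algebraMap S F f₀ := Subtype.ext (by simp [hf₀]; rfl)
        rw [this]
        exact isIntegral_algebraMap
      obtain ⟨y, hy⟩ := IsIntegrallyClosed.exists_algebraMap_eq_of_isIntegral_pow hp.pos hint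
      have : (y : K) = t := congrArg Subtype.val hy
      exact this ▸ y.2
    -- `A := A₀[t]`
    set A : Subalgebra k K := Algebra.adjoin k (insert t (A₀ : Set K)) with hAdef
    have hA₀A : A₀ ≤ A := fun x hx => Algebra.subset_adjoin (Set.mem_insert_of_mem t hx)
    have htA : t ∈ A := Algebra.subset_adjoin (Set.mem_insert t _)
    have hAS : A.toSubring ≤ S := by
      rw [hAdef, Algebra.adjoin_eq_ring_closure]
      refine Subring.closure_le.mpr ?_
      rintro x (⟨c, rfl⟩ | rfl | hx)
      · exact hA₀S (A₀.algebraMap_mem c)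
      · exact htS
      · exact hA₀S hx
    have hAO : A.toSubring ≤ O.toSubring := hAS.trans hSO
    have heq : locAtCentre A.toSubring O = locAtCentre A₀.toSubring O :=
      locAtCentre_eq_of_le_of_le O hA₀A hAS
    refine ⟨A, hAO, hA₀A, htA, ?_, hfrac, ?_⟩
    · refine ⟨insert t G₀, ?_⟩
      rw [Finset.coe_insert, hAdef, ← hG₀, Algebra.adjoin_insert_adjoin]
    · exact isRegularLocalRing_centre_of_locAtCentre_eq h₀ hAO heq hreg
  · -- genuine torsor: `h` is irreducible over `F = Frac S`
    have hirr : Irreducible (h.map (algebraMap S F)) := by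
      have hmap : h.map (algebraMap S F) = X ^ p - C (algebraMap S F f₀) := by
        simp [hhdef]
      rw [hmap]
      refine X_pow_sub_C_irreducible_of_prime hp ?_
      intro b hb
      apply htF
      have hbK : (b : K) ^ p = t ^ p := by
        have := congrArg Subtype.val hb
        rw [hf₀F] at this
        simpa using this
      haveI : ExpChar K p := ExpChar.prime hp
      have hbt : (b : K) = t := frobenius_inj K p (by simpa [frobenius_def] using hbK)
      rw [← hbt]
      exact b.2
    -- `K = F(t)`
    have htop : Algebra.adjoin F ({t} : Set K) = ⊤ := by
      have hint : IsIntegral F t := by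
        refine ⟨h.map (algebraMap S F), hmonic.map _, ?_⟩
        rw [eval₂_map, ← IsScalarTower.algebraMap_eq, ← aeval_def, haeval]
      rw [← IntermediateField.adjoin_simple_toSubalgebra_of_isAlgebraic hint.isAlgebraic,
        ← IntermediateField.top_toSubalgebra]
      congr 1
      rw [eq_top_iff]
      intro x _
      obtain ⟨a, b, -, rfl⟩ := IsFractionRing.div_surjective (A := Algebra.adjoin k (insert t (A₀ : Set K))) x
      -- `A₀[t] ⊆ F⟮t⟯`
      have hsub : (Algebra.adjoin k (insert t (A₀ : Set K))).toSubring ≤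
          (IntermediateField.adjoin F ({t} : Set K)).toSubring := by
        rw [Algebra.adjoin_eq_ring_closure]
        refine Subring.closure_le.mpr ?_
        have hFt : ∀ y ∈ F, y ∈ IntermediateField.adjoin F ({t} : Set K) := fun y hy =>
          IntermediateField.algebraMap_mem _ (⟨y, hy⟩ : F)
        rintro y (⟨c, rfl⟩ | rfl | hy)
        · exact hFt _ (hSF _ (hA₀S (A₀.algebraMap_mem c)))
        · exact IntermediateField.subset_adjoin F _ (Set.mem_singleton y)
        · exact hFt _ (hSF _ (hA₀S hy))
      exact div_mem (hsub a.2) (hsub b.2)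
    -- apply the local theorem
    obtain ⟨t', ht', hreg'⟩ := hloc p hp S hexc hdim hchar F K h t hmonic hdeg hirr haeval htop
      (Or.inl ⟨inferInstance, hcoeff⟩) O (fun s => hSO s.2)
      (fun s hs => (mem_maximalIdeal_locAtCentre_iff h₀ s).mp hs)
    -- convert `S[t][t']` regular at the centre into `Concl`
    set C : Subring K := (Algebra.adjoin S (insert t (t' : Set K))).toSubring with hCdef
    have hSC : ∀ x ∈ S, x ∈ C := fun x hx =>
      (Algebra.adjoin S (insert t (t' : Set K))).algebraMap_mem (⟨x, hx⟩ : S)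
    set A : Subalgebra k K := Algebra.adjoin k (insert t ((G₀ : Set K) ∪ (t' : Set K))) with hAdef
    have hA₀A : A₀ ≤ A := by
      rw [← hG₀]
      exact Algebra.adjoin_mono (fun x hx => Set.mem_insert_of_mem t (Or.inl hx))
    have htA : t ∈ A := Algebra.subset_adjoin (Set.mem_insert t _)
    have ht'A : (t' : Set K) ⊆ A := fun x hx => Algebra.subset_adjoin (Set.mem_insert_of_mem t (Or.inr hx))
    have hG₀A₀ : (G₀ : Set K) ⊆ A₀ := by rw [← hG₀]; exact Algebra.subset_adjoin
    have hAC : A.toSubring ≤ C := by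
      rw [hAdef, Algebra.adjoin_eq_ring_closure]
      refine Subring.closure_le.mpr ?_
      rintro x (⟨c, rfl⟩ | rfl | hx | hx)
      · exact hSC _ (hA₀S (A₀.algebraMap_mem c))
      · exact Algebra.subset_adjoin (Set.mem_insert x _)
      · exact hSC _ (hA₀S (hG₀A₀ hx))
      · exact Algebra.subset_adjoin (Set.mem_insert_of_mem t hx)
    have hAO : A.toSubring ≤ O.toSubring := hAC.trans ht'
    have hCloc : C ≤ locAtCentre A.toSubring O := by
      rw [hCdef, Algebra.adjoin_eq_ring_closure]
      refine Subring.closure_le.mpr ?_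
      rintro x (⟨s, rfl⟩ | rfl | hx)
      · exact locAtCentre_mono O (show A₀.toSubring ≤ A.toSubring from hA₀A) s.2
      · exact le_locAtCentre _ O htA
      · exact le_locAtCentre _ O (ht'A hx)
    have heq : locAtCentre C O = locAtCentre A.toSubring O := locAtCentre_eq_of_le_of_le O hAC hCloc
    haveI := hfrac
    refine ⟨A, hAO, hA₀A, htA, ?_, ?_, ?_⟩
    · refine ⟨insert t (G₀ ∪ t'), ?_⟩
      rw [Finset.coe_insert, Finset.coe_union]
    · exact isFractionRing_subalgebra_of_le (Algebra.adjoin k (insert t (A₀ : Set K))) A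
        (Algebra.adjoin_le (Set.insert_subset htA (fun x hx => hA₀A hx)))
    · exact isRegularLocalRing_centre_of_locAtCentre_eq ht' hAO heq.symm hreg'

/-! ## Wrappers: all dimensions; dimensions `≤ n` at transcendence degree `≤ n`; the torsor consequents -/

/-- **Placement, all levels.** If Cossart–Piltant's local theorem holds in every ambient dimension, every torsor
datum regular at the centre satisfies `Concl`. [cite: CossartPiltant2019, Thm. 1.5 (arXiv v1: Thm. 1.4), with 3 ↦ d] -/
theorem concl_of_forall_localTheoremInDim (p : ℕ) (hp : p.Prime) [CharP k p]
    (hloc : ∀ d : ℕ, LocalTheoremInDim.{0} d)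
    (O : ValuationSubring K) (A₀ : Subalgebra k K) (h₀ : A₀.toSubring ≤ O.toSubring) (t : K)
    (hfg : A₀.FG) (htp : t ^ p ∈ A₀)
    (hfrac : IsFractionRing (Algebra.adjoin k (insert t (A₀ : Set K))) K)
    (hreg : IsRegularLocalRing (Localization.AtPrime
      (Ideal.comap (Subring.inclusion h₀) (IsLocalRing.maximalIdeal O)))) :
    Concl O A₀ t := by
  haveI : IsLocalRing (locAtCentre A₀.toSubring O) := isLocalRing_locAtCentre h₀
  haveI : IsRegularLocalRing (locAtCentre A₀.toSubring O) :=
    (isRegularLocalRing_locAtCentre_iff h₀).mpr hreg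
  obtain ⟨d, hd⟩ := ringKrullDim_eq_nat (R := locAtCentre A₀.toSubring O)
  exact concl_of_localTheoremInDim p d hp (hloc d) O A₀ h₀ t hfg htp hfrac hreg hd

/-- The local ring at the centre of a model of `K/k` has Krull dimension at most `trdeg_k K`
(`dim B_𝔭 = ht 𝔭 ≤ dim B ≤ trdeg_k B ≤ trdeg_k K`). [cite: Matsumura1987, §5 p. 30 and Thm. 5.6] -/
theorem ringKrullDim_locAtCentre_le (O : ValuationSubring K) (A₀ : Subalgebra k K)
    (h₀ : A₀.toSubring ≤ O.toSubring) {n : ℕ} (hn : Algebra.trdeg k K ≤ n) :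
    ringKrullDim (locAtCentre A₀.toSubring O) ≤ n := by
  haveI := isLocalization_locAtCentre (B := A₀.toSubring) (O := O) h₀
  rw [IsLocalization.AtPrime.ringKrullDim_eq_height (subringCentre A₀.toSubring O h₀)
    (locAtCentre A₀.toSubring O)]
  have h1 : ((subringCentre A₀.toSubring O h₀).height : WithBot ℕ∞) ≤ ringKrullDim A₀.toSubring :=
    Ideal.height_le_ringKrullDim_of_isPrime
  have h2 : ringKrullDim A₀ ≤ n := by
    refine ringKrullDim_le_of_trdeg_le (k := k) ?_
    exact (trdeg_le_of_injective A₀.val Subtype.val_injective).trans hn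
  exact h1.trans h2

/-- **Placement at level `n`.** At transcendence degree `≤ n`, `Concl` follows from the local theorem in the ambient
dimensions `≤ n`. [cite: CossartPiltant2019, Thm. 1.5 (arXiv v1: Thm. 1.4), with 3 ↦ d] -/
theorem concl_of_localTheoremInDim_le (p n : ℕ) (hp : p.Prime) [CharP k p]
    (hloc : ∀ d : ℕ, d ≤ n → LocalTheoremInDim.{0} d)
    (O : ValuationSubring K) (A₀ : Subalgebra k K) (h₀ : A₀.toSubring ≤ O.toSubring) (t : K)
    (hn : Algebra.trdeg k K ≤ n) (hfg : A₀.FG) (htp : t ^ p ∈ A₀)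
    (hfrac : IsFractionRing (Algebra.adjoin k (insert t (A₀ : Set K))) K)
    (hreg : IsRegularLocalRing (Localization.AtPrime
      (Ideal.comap (Subring.inclusion h₀) (IsLocalRing.maximalIdeal O)))) :
    Concl O A₀ t := by
  haveI : IsLocalRing (locAtCentre A₀.toSubring O) := isLocalRing_locAtCentre h₀
  haveI : IsRegularLocalRing (locAtCentre A₀.toSubring O) :=
    (isRegularLocalRing_locAtCentre_iff h₀).mpr hreg
  obtain ⟨d, hd⟩ := ringKrullDim_eq_nat (R := locAtCentre A₀.toSubring O)
  have hdn : d ≤ n := by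
    have := ringKrullDim_locAtCentre_le O A₀ h₀ hn
    rw [hd] at this
    exact_mod_cast this
  exact concl_of_localTheoremInDim p d hp (hloc d hdn) O A₀ h₀ t hfg htp hfrac hreg hd

/-- **Dimension three is in print.** When the local ring at the centre has Krull dimension `3`, `Concl` follows from the
PRINTED local theorem `CossartPiltant2019Local` (via `localTheoremInDim_three_iff`).
[cite: CossartPiltant2019, Thm. 1.5 (arXiv v1: Thm. 1.4)] -/
theorem concl_of_cossartPiltant2019Local (p : ℕ) (hp : p.Prime) [CharP k p]
    (h3 : CossartPiltant2019Local.{0})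
    (O : ValuationSubring K) (A₀ : Subalgebra k K) (h₀ : A₀.toSubring ≤ O.toSubring) (t : K)
    (hfg : A₀.FG) (htp : t ^ p ∈ A₀)
    (hfrac : IsFractionRing (Algebra.adjoin k (insert t (A₀ : Set K))) K)
    (hreg : IsRegularLocalRing (Localization.AtPrime
      (Ideal.comap (Subring.inclusion h₀) (IsLocalRing.maximalIdeal O))))
    (hdim : ringKrullDim (locAtCentre A₀.toSubring O) = 3) :
    Concl O A₀ t :=
  concl_of_localTheoremInDim p 3 hp (localTheoremInDim_three_iff.mpr h3) O A₀ h₀ t hfg htp hfrac hreg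
    (by simpa using hdim)

/-- **The torsor consequent of the crux `Steer`, prime by prime, from the local theorem in all dimensions**:
`TorsorLU p` (the body of `TorsorLUPerfect` at `p`; neither perfectness of `k` nor any hypothesis on `O` is used).
[cite: CossartPiltant2019, Thm. 1.5 (arXiv v1: Thm. 1.4), with 3 ↦ d] [cite: Temkin2013, Rem. 1.3.5] -/
theorem torsorLU_of_forall_localTheoremInDim (p : ℕ) (hp : p.Prime)
    (hloc : ∀ d : ℕ, LocalTheoremInDim.{0} d) : TorsorLU p := by
  intro k K _ _ _ _ _ O A₀ h₀ t hfg htp hfrac hreg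
  exact concl_of_forall_localTheoremInDim p hp hloc O A₀ h₀ t hfg htp hfrac hreg

/-- The same at zero-dimensional valuation rings (`TorsorLUZeroDim p`, the consequent slice served to the line's
frontier stubs; the zero-dimensionality hypothesis is not used).
[cite: CossartPiltant2019, Thm. 1.5 (arXiv v1: Thm. 1.4), with 3 ↦ d] -/
theorem torsorLUZeroDim_of_forall_localTheoremInDim (p : ℕ) (hp : p.Prime)
    (hloc : ∀ d : ℕ, LocalTheoremInDim.{0} d) : TorsorLUZeroDim p := by
  intro k K _ _ _ _ _ O A₀ h₀ t _ hfg htp hfrac hreg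
  exact concl_of_forall_localTheoremInDim p hp hloc O A₀ h₀ t hfg htp hfrac hreg

end Torsor

/-! ## The skeleton's `CoreDatum` form -/

section Core

variable {k K : Type} [Field k] [Field K] [Algebra k K]

/-- **Placement of the skeleton's frontier stubs.** Under a core datum `CoreDatum p n k K O A₀ h₀ t` (which
records `A₀.FG`, `t ^ p ∈ A₀`, `Frac (A₀[t]) = K`, regularity at the centre and `trdeg_k K = n`), `Concl O A₀ t`
follows from the local theorem in the ambient dimensions `≤ n`; in particular each of the four frontier stubs of the
skeleton of record (whose conclusion is `Concl O A₀ t` under `CoreDatum p n …` and further hypotheses) is implied by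
`∀ d ≤ n, LocalTheoremInDim d`. [cite: CossartPiltant2019, Thm. 1.5 (arXiv v1: Thm. 1.4), with 3 ↦ n] -/
theorem concl_of_coreDatum_of_localTheoremInDim_le (p n : ℕ) (hp : p.Prime) [CharP k p]
    (hloc : ∀ d : ℕ, d ≤ n → LocalTheoremInDim.{0} d)
    (O : ValuationSubring K) (A₀ : Subalgebra k K) (h₀ : A₀.toSubring ≤ O.toSubring) (t : K)
    (core : CoreDatum p n k K O A₀ h₀ t) : Concl O A₀ t := by
  obtain ⟨hfg, htp, hfrac, hreg, -, -, -, -, -, -, -, -, htr, -⟩ := core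
  exact concl_of_localTheoremInDim_le p n hp hloc O A₀ h₀ t htr.le hfg htp hfrac hreg

end Core

end Summit.ResolutionOfSingularities.ResolutionOfSingularities.Theorems.SwitchingDichotomy.Placement
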